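import Mathlib.MeasureTheory.Measure.Prokhorov
import Mathlib.MeasureTheory.Measure.LevyProkhorovMetric
import Mathlib.MeasureTheory.Measure.Portmanteau
import Mathlib.MeasureTheory.Integral.Bochner.Basic
import Mathlib.Topology.Metrizable.CompletelyMetrizable
import Mathlib.Analysis.Real.Sqrt
import Mathlib.Topology.MetricSpace.HausdorffDistance
import HarnessLib

/-!
# Subsequential joint limits in law of `(X_k, (v_kⁱ)_{i ∈ ι})` from coordinate second moments

Topic `Literature/Probability/Distributions`; glue of weak-convergence bookkeeping in the setting
of `JointLawTruncatedLimit.lean` / `JointLawClosedConstraint.lean` (random elements `X_k` of a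
metrisable Borel space `E` together with real random vectors `v_k`), written for the
**tightness / Prokhorov sub-node** of the Garban–Pete–Schramm joint limit
`(ω_δ, (⟨μ^{εᵢ}_δ(ω), φᵢ⟩)ᵢ) ⇒ (S, …)` of a lattice configuration with the integrals of
countably many test functions against its pivotal measures (route
`Summits/CriticalPhenomena/CardyFormulaZ2/Theses/CardyMeckeFlip`, crux `FlipErgodicityZ2`, stub
`stub_jointKernelLimit`; Garban–Pete–Schramm 2013 Thm. 4.3 / §4.7 transplanted to bond-`ℤ²`),
but model-free.

**Setting.**  A probability space `(Ω, P)`, measurable `X_k : Ω → E` (`E` metrisable separable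
Borel; in the application the compact Schramm–Smirnov space `ℋ`) and measurable
`v_k : Ω → (ι → ℝ)` with `ι` COUNTABLE (`ι → ℝ` carries the product topology, a Polish space), such
that the laws of the `X_k` are tight (automatic for compact `E`, `IsTightMeasureSet.of_compactSpace`)
and every coordinate has uniformly bounded second moments, `sup_k E[(v_kⁱ)²] < ∞`.

**Results.**
* `isTightMeasureSet_of_forall_lintegral_le` — Markov: `∫ V dρ ≤ C < ∞` for a measurable
  `V ≥ 0` with compact sublevel sets makes a family tight (cf. the continuous `ℝ≥0`-valued case
  `Literature.Probability.Process.isTightMeasureSet_of_lintegral_le` of `KrylovBogoliubov.lean`);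
* `isTightMeasureSet_pi_of_map_eval` — **a family of laws on a countable product is tight as soon
  as every family of coordinate marginals is** (budget `ε = Σᵢ εᵢ`, compact `Πᵢ Kᵢ`);
* `isTightMeasureSet_pi_of_lintegral_sq_le`, `isTightMeasureSet_prod_of_lintegral_sq_le` —
  uniformly bounded coordinate second moments (and tight first marginals) give tightness on
  `ι → ℝ`, resp. `E × (ι → ℝ)`;
* `exists_subseq_tendsto_of_isTightMeasureSet_range` — Prokhorov (Mathlib
  `isCompact_closure_of_isTightMeasureSet`) + Lévy–Prokhorov metrisability of
  `ProbabilityMeasure`: a tight sequence of laws has a weakly convergent subsequence;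
* `lintegral_ofReal_le_of_tendsto` — Fatou along weak convergence for a continuous `f ≥ 0`
  (portmanteau for open sets + layer-cake), so moment bounds pass to the limit law;
* `ae_mem_of_isClosed_of_tendsto_law` — closed constraints satisfied almost surely along the
  sequence hold almost surely under the limit law (law-level twin of
  `ae_mem_of_isClosed_of_tendsto_pair`);
* **`exists_subseq_tendsto_pair_law`** — the package: a subsequence `ψ` and a probability law `ν`
  on `E × (ι → ℝ)` with `E G(X_{ψ k}, v_{ψ k}) → ∫ G dν` for every bounded continuous `G`, the
  coordinate second moments of `ν` obeying the same bounds;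
* `fst_eq_of_tendsto_pair_law` — the first marginal of any such `ν` is the weak limit of the laws
  of the `X_k` when that limit exists;
* `lintegral_ofReal_sq_le_of_abs_le` — the Bochner-side bookkeeping `|t| ≤ s`, `E[s²] ≤ C`
  `⟹ ∫⁻ t² ≤ C` feeding the moment hypothesis.

What is NOT here: that the limit law `ν` is supported on a graph `{(S, T S)}` (the limit vector a
FUNCTION of the limit configuration) — for the pivotal measures this is Garban–Pete–Schramm's
coupling argument (2013, §4.3–4.6), not a soft fact.

## References

* P. Billingsley, *Convergence of Probability Measures*, 2nd ed. (1999), Thms. 5.1–5.2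
  (Prokhorov) and Thm. 2.1 (portmanteau) — combined here in the form the consumers use.
-/

noncomputable section

open Set Filter Function Metric
open _root_.MeasureTheory _root_.Topology _root_.TopologicalSpace
open scoped ENNReal NNReal BoundedContinuousFunction

namespace Literature.Probability.Distributions

/-! ### Tightness from a Lyapunov moment bound -/

/-- **Markov's inequality ⇒ tightness.**  Measures `ρ` with `∫ V dρ ≤ C < ∞` for a measurable
`V : X → [0, ∞]` whose sublevel sets `{V ≤ R}` are compact form a tight set: `ρ {V > R} ≤ C / R`.
[folklore] -/
theorem isTightMeasureSet_of_forall_lintegral_le {X : Type*} [MeasurableSpace X]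
    [TopologicalSpace X] {V : X → ℝ≥0∞} (hV : Measurable V)
    (hcpt : ∀ R : ℝ≥0, IsCompact {x | V x ≤ R}) {C : ℝ≥0∞} (hC : C ≠ ∞)
    {S : Set (Measure X)} (hS : ∀ ρ ∈ S, ∫⁻ x, V x ∂ρ ≤ C) : IsTightMeasureSet S := by
  rw [isTightMeasureSet_iff_exists_isCompact_measure_compl_le]
  intro ε hε
  rcases eq_or_ne ε ∞ with rfl | hεtop
  · exact ⟨∅, isCompact_empty, fun _ _ => le_top⟩
  -- a level `R > 0` with `C ≤ ε R`
  have hCε : C / ε ≠ ∞ := ENNReal.div_ne_top hC hε.ne'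
  set R : ℝ≥0 := (C / ε).toNNReal + 1 with hR
  have hR0 : (R : ℝ≥0∞) ≠ 0 := by positivity
  have hCR : C ≤ ε * R :=
    calc C = ε * (C / ε) := (ENNReal.mul_div_cancel hε.ne' hεtop).symm
      _ ≤ ε * R := by
          gcongr
          rw [hR, ENNReal.coe_add, ENNReal.coe_toNNReal hCε, ENNReal.coe_one]
          exact le_self_add
  refine ⟨{x | V x ≤ R}, hcpt R, fun ρ hρ => ?_⟩
  calc ρ {x | V x ≤ R}ᶜ ≤ ρ {x | (R : ℝ≥0∞) ≤ V x} :=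
        measure_mono fun x (hx : ¬V x ≤ R) => (not_le.1 hx).le
    _ ≤ (∫⁻ x, V x ∂ρ) / R := meas_ge_le_lintegral_div hV.aemeasurable hR0 ENNReal.coe_ne_top
    _ ≤ C / R := by gcongr; exact hS ρ hρ
    _ ≤ ε := by rwa [ENNReal.div_le_iff hR0 ENNReal.coe_ne_top]

/-- The sublevel sets of `x ↦ x²` on `ℝ` (read in `[0, ∞]`) are the compact intervals
`[-√R, √R]`. [folklore] -/
theorem isCompact_setOf_ofReal_sq_le (R : ℝ≥0) :
    IsCompact {x : ℝ | ENNReal.ofReal (x ^ 2) ≤ R} := by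
  have hset : {x : ℝ | ENNReal.ofReal (x ^ 2) ≤ R} = Icc (-Real.sqrt R) (Real.sqrt R) := by
    ext x
    rw [mem_setOf_eq, ENNReal.ofReal_le_iff_le_toReal ENNReal.coe_ne_top, ENNReal.coe_toReal,
      Real.sq_le R.coe_nonneg, mem_Icc]
  rw [hset]
  exact isCompact_Icc

/-! ### Tightness on countable products -/

/-- **Tightness on a countable product from tightness of the coordinates.**  If for every
coordinate `i` the family of `i`-th marginals `{ρ ∘ evalᵢ⁻¹ | ρ ∈ S}` is tight, then `S` is tight:
given `ε = Σᵢ εᵢ`, choose compact `Kᵢ` with `ρ(evalᵢ ∉ Kᵢ) ≤ εᵢ` and take the compact `Πᵢ Kᵢ`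
(Tychonoff), whose complement is `⋃ᵢ {evalᵢ ∉ Kᵢ}`. [folklore] -/
theorem isTightMeasureSet_pi_of_map_eval {ι : Type*} [Countable ι] {X : ι → Type*}
    [∀ i, TopologicalSpace (X i)] [∀ i, MeasurableSpace (X i)] {S : Set (Measure (Π i, X i))}
    (h : ∀ i, IsTightMeasureSet ((fun ρ : Measure (Π i, X i) => ρ.map (fun x => x i)) '' S)) :
    IsTightMeasureSet S := by
  rw [isTightMeasureSet_iff_exists_isCompact_measure_compl_le]
  intro ε hε
  obtain ⟨δ, hδpos, hδsum⟩ := ENNReal.exists_pos_sum_of_countable' hε.ne' ι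
  have hK : ∀ i, ∃ K : Set (X i), IsCompact K ∧
      ∀ ρ ∈ S, (ρ.map (fun x : (Π i, X i) => x i)) Kᶜ ≤ δ i := by
    intro i
    obtain ⟨K, hKc, hK⟩ :=
      isTightMeasureSet_iff_exists_isCompact_measure_compl_le.1 (h i) (δ i) (hδpos i)
    exact ⟨K, hKc, fun ρ hρ => hK _ (mem_image_of_mem _ hρ)⟩
  choose K hKc hK using hK
  refine ⟨Set.pi univ K, isCompact_univ_pi hKc, fun ρ hρ => ?_⟩
  have hsub : (Set.pi univ K)ᶜ ⊆ ⋃ i, (fun x : (Π i, X i) => x i) ⁻¹' (K i)ᶜ := by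
    intro x hx
    simp only [mem_compl_iff, mem_univ_pi, not_forall] at hx
    obtain ⟨i, hi⟩ := hx
    exact mem_iUnion.2 ⟨i, hi⟩
  calc ρ (Set.pi univ K)ᶜ ≤ ρ (⋃ i, (fun x : (Π i, X i) => x i) ⁻¹' (K i)ᶜ) := measure_mono hsub
    _ ≤ ∑' i, ρ ((fun x : (Π i, X i) => x i) ⁻¹' (K i)ᶜ) := measure_iUnion_le _
    _ ≤ ∑' i, (ρ.map (fun x : (Π i, X i) => x i)) (K i)ᶜ :=
        ENNReal.tsum_le_tsum fun i => Measure.le_map_apply (measurable_pi_apply i).aemeasurable _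
    _ ≤ ∑' i, δ i := ENNReal.tsum_le_tsum fun i => hK i ρ hρ
    _ ≤ ε := hδsum.le

/-- **Uniformly bounded coordinate second moments ⇒ tightness on `ι → ℝ`** (`ι` countable,
product topology): if `∫ xᵢ² dρ ≤ Cᵢ < ∞` for all `ρ ∈ S` and all `i`, then `S` is tight
(Chebyshev in each coordinate, then `isTightMeasureSet_pi_of_map_eval`). [folklore] -/
theorem isTightMeasureSet_pi_of_lintegral_sq_le {ι : Type*} [Countable ι]
    {S : Set (Measure (ι → ℝ))} (C : ι → ℝ≥0∞) (hC : ∀ i, C i ≠ ∞)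
    (h : ∀ ρ ∈ S, ∀ i, ∫⁻ x, ENNReal.ofReal ((x i) ^ 2) ∂ρ ≤ C i) : IsTightMeasureSet S := by
  refine isTightMeasureSet_pi_of_map_eval fun i => ?_
  have hVm : Measurable fun x : ℝ => ENNReal.ofReal (x ^ 2) :=
    (measurable_id.pow_const 2).ennreal_ofReal
  refine isTightMeasureSet_of_forall_lintegral_le hVm isCompact_setOf_ofReal_sq_le (hC i) ?_
  rintro _ ⟨ρ, hρ, rfl⟩
  rw [lintegral_map hVm (measurable_pi_apply i)]
  exact h ρ hρ i

/-- **Tight first marginals and bounded coordinate second moments ⇒ joint tightness** on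
`E × (ι → ℝ)` (Mathlib's `IsTightMeasureSet.prodMk`).  For compact `E` the first hypothesis is
`IsTightMeasureSet.of_compactSpace`. [folklore] -/
theorem isTightMeasureSet_prod_of_lintegral_sq_le {E ι : Type*} [TopologicalSpace E]
    [MeasurableSpace E] [Countable ι] {S : Set (Measure (E × (ι → ℝ)))}
    (h₁ : IsTightMeasureSet (Measure.fst '' S)) (C : ι → ℝ≥0∞) (hC : ∀ i, C i ≠ ∞)
    (h : ∀ ρ ∈ S, ∀ i, ∫⁻ p, ENNReal.ofReal ((p.2 i) ^ 2) ∂ρ ≤ C i) : IsTightMeasureSet S := by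
  refine IsTightMeasureSet.prodMk h₁ (isTightMeasureSet_pi_of_lintegral_sq_le C hC ?_)
  rintro _ ⟨ρ, hρ, rfl⟩ i
  have hVm : Measurable fun x : ι → ℝ => ENNReal.ofReal ((x i) ^ 2) :=
    ((measurable_pi_apply i).pow_const 2).ennreal_ofReal
  rw [Measure.snd, lintegral_map hVm measurable_snd]
  exact h ρ hρ i

/-! ### Prokhorov: weakly convergent subsequences, and Fatou along them -/

/-- **A tight sequence of probability laws on a metrisable separable Borel space has a weakly
convergent subsequence** (Prokhorov, Mathlib `isCompact_closure_of_isTightMeasureSet`, plus the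
Lévy–Prokhorov metrisability of `ProbabilityMeasure α`, which makes compact sets sequentially
compact). [folklore] -/
theorem exists_subseq_tendsto_of_isTightMeasureSet_range {α : Type*} [TopologicalSpace α]
    [MetrizableSpace α] [SeparableSpace α] [MeasurableSpace α] [BorelSpace α]
    (ρ : ℕ → ProbabilityMeasure α)
    (h : IsTightMeasureSet (Set.range fun k => (ρ k : Measure α))) :
    ∃ ν : ProbabilityMeasure α, ∃ ψ : ℕ → ℕ, StrictMono ψ ∧ Tendsto (ρ ∘ ψ) atTop (𝓝 ν) := by
  have h' : IsTightMeasureSet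
      {x | ∃ μ ∈ Set.range ρ, ((μ : ProbabilityMeasure α) : Measure α) = x} := by
    refine h.subset ?_
    rintro _ ⟨_, ⟨k, rfl⟩, rfl⟩
    exact ⟨k, rfl⟩
  obtain ⟨ν, -, ψ, hψ, hlim⟩ := (isCompact_closure_of_isTightMeasureSet h').tendsto_subseq
    (fun k => subset_closure (mem_range_self k))
  exact ⟨ν, ψ, hψ, hlim⟩

/-- **Fatou along weak convergence.**  If probability laws `ρ_k → ν` weakly and `f ≥ 0` is
continuous with `∫ f dρ_k ≤ C` for all `k`, then `∫ f dν ≤ C` (portmanteau for open sets and the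
layer-cake formula, Mathlib
`lintegral_le_liminf_lintegral_of_forall_isOpen_measure_le_liminf_measure`). [folklore] -/
theorem lintegral_ofReal_le_of_tendsto {α : Type*} [TopologicalSpace α] [MeasurableSpace α]
    [OpensMeasurableSpace α] [HasOuterApproxClosed α] {ρ : ℕ → ProbabilityMeasure α}
    {ν : ProbabilityMeasure α} (hlim : Tendsto ρ atTop (𝓝 ν)) {f : α → ℝ} (hf : Continuous f)
    (hf0 : 0 ≤ f) {C : ℝ≥0∞} (hC : ∀ k, ∫⁻ x, ENNReal.ofReal (f x) ∂(ρ k : Measure α) ≤ C) :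
    ∫⁻ x, ENNReal.ofReal (f x) ∂(ν : Measure α) ≤ C := by
  refine (lintegral_le_liminf_lintegral_of_forall_isOpen_measure_le_liminf_measure
    (μs := fun k => (ρ k : Measure α)) hf hf0
    fun G hG => ProbabilityMeasure.le_liminf_measure_open_of_tendsto hlim hG).trans ?_
  exact liminf_le_of_frequently_le' (Eventually.of_forall hC).frequently

/-! ### Closed constraints pass to the limit law -/

/-- **Closed constraints pass to the limit law, almost surely** (law-level twin of
`ae_mem_of_isClosed_of_tendsto_pair` of `JointLawClosedConstraint.lean`, for a limit law that is
not known to be supported on a graph): if `E G(Y_k) → ∫ G dν` for every bounded continuous `G`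
on a pseudo-metrisable space, `R` is closed and `Y_k ∈ R` almost surely for all large `k`, then
`ν`-almost every point lies in `R` (test `G = min 1 (dist(·, R))`, whose integrals along the
sequence vanish). [folklore] -/
theorem ae_mem_of_isClosed_of_tendsto_law {Ω α : Type*} [MeasurableSpace Ω] {P : Measure Ω}
    [TopologicalSpace α] [PseudoMetrizableSpace α] [MeasurableSpace α] [OpensMeasurableSpace α]
    {Y : ℕ → Ω → α} {ν : Measure α} [IsFiniteMeasure ν]
    (hconv : ∀ G : α →ᵇ ℝ, Tendsto (fun k => ∫ ω, G (Y k ω) ∂P) atTop (𝓝 (∫ p, G p ∂ν)))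
    {R : Set α} (hR : IsClosed R) (hY : ∀ᶠ k in atTop, ∀ᵐ ω ∂P, Y k ω ∈ R) :
    ∀ᵐ p ∂ν, p ∈ R := by
  letI : PseudoMetricSpace α := pseudoMetrizableSpacePseudoMetric α
  rcases R.eq_empty_or_nonempty with rfl | hRne
  · -- `R = ∅`: then `P = 0` for large `k`, all limit integrals vanish, `ν = 0`
    have h1 : ∫ p, (1 : α →ᵇ ℝ) p ∂ν = 0 := by
      refine tendsto_nhds_unique (hconv 1) (tendsto_const_nhds.congr' ?_)
      filter_upwards [hY] with k hk
      have hP : P = 0 := by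
        rw [← Measure.measure_univ_eq_zero]
        have : ∀ᵐ ω ∂P, ω ∉ (univ : Set Ω) := hk.mono fun ω hω _ => hω
        exact measure_eq_zero_iff_ae_notMem.2 this
      rw [hP, integral_zero_measure]
    have hν : ν = 0 := by
      simp only [BoundedContinuousFunction.coe_one, Pi.one_apply, integral_const, smul_eq_mul,
        mul_one] at h1
      rw [← Measure.measure_univ_eq_zero]
      exact (measureReal_eq_zero_iff (measure_ne_top ν _)).1 h1
    rw [hν, ae_zero]
    exact eventually_bot
  -- the test function
  set D : α → ℝ := fun p => min 1 (infDist p R) with hD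
  have hDc : Continuous D := continuous_const.min (continuous_infDist_pt (s := R))
  have hD0 : ∀ p, 0 ≤ D p := fun p => le_min zero_le_one infDist_nonneg
  have hD1 : ∀ p, ‖D p‖ ≤ 1 := fun p => by
    rw [Real.norm_eq_abs, abs_of_nonneg (hD0 p)]
    exact min_le_left _ _
  set G : α →ᵇ ℝ := BoundedContinuousFunction.ofNormedAddCommGroup D hDc 1 hD1 with hG
  have hGD : ∀ p, G p = D p := fun p => rfl
  -- its integrals along the sequence vanish eventually, hence so does the limit integral
  have hk : ∀ᶠ k in atTop, ∫ ω, G (Y k ω) ∂P = 0 := by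
    filter_upwards [hY] with k hk
    have h0 : (fun ω => G (Y k ω)) =ᵐ[P] fun _ => 0 := by
      filter_upwards [hk] with ω hω
      rw [hGD, hD]
      simp only [infDist_zero_of_mem hω]
      exact min_eq_right zero_le_one
    rw [integral_congr_ae h0, integral_zero]
  have hlim : ∫ p, G p ∂ν = 0 :=
    tendsto_nhds_unique (hconv G) (tendsto_const_nhds.congr' (hk.mono fun k hk => hk.symm))
  have hint : Integrable (fun p => G p) ν :=
    Integrable.of_bound G.continuous.measurable.aestronglyMeasurable 1 (ae_of_all _ fun p => hD1 _)
  have hae := (integral_eq_zero_iff_of_nonneg (fun p => hD0 _) hint).1 hlim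
  filter_upwards [hae] with p hp
  have h1 : min 1 (infDist p R) = 0 := hp
  have h2 : infDist p R = 0 := by
    rcases min_choice (1 : ℝ) (infDist p R) with h' | h'
    · rw [h'] at h1; exact absurd h1 one_ne_zero
    · rwa [h'] at h1
  exact (hR.mem_iff_infDist_zero hRne).2 h2

/-! ### The package for pairs `(X_k, v_k)` -/

section Pair

variable {Ω E ι : Type*} [MeasurableSpace Ω] {P : Measure Ω} [IsProbabilityMeasure P]
  [TopologicalSpace E] [MetrizableSpace E] [SeparableSpace E] [MeasurableSpace E] [BorelSpace E]
  [Countable ι]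

/-- **Subsequential joint limit in law from tightness of the first coordinate and second-moment
bounds on the others.**  Let `X_k : Ω → E` be measurable with tight laws (`E` metrisable
separable Borel), and `v_k : Ω → (ι → ℝ)` measurable (`ι` countable) with
`sup_k ∫ (v_kⁱ)² dP ≤ Cᵢ < ∞` for every `i`.  Then along some subsequence `ψ` the pairs
`(X_{ψ k}, v_{ψ k})` converge in law — `E G(X_{ψ k}, v_{ψ k}) → ∫ G dν` for every bounded
continuous `G : E × (ι → ℝ) → ℝ` — to a probability law `ν` whose coordinate second moments obey
the same bounds.  (Tightness `isTightMeasureSet_prod_of_lintegral_sq_le`, Prokhorov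
`exists_subseq_tendsto_of_isTightMeasureSet_range`, Fatou `lintegral_ofReal_le_of_tendsto`.)
[folklore] -/
theorem exists_subseq_tendsto_pair_law {X : ℕ → Ω → E} {v : ℕ → Ω → ι → ℝ}
    (hX : ∀ k, Measurable (X k)) (hv : ∀ k, Measurable (v k))
    (hXt : IsTightMeasureSet (Set.range fun k => P.map (X k)))
    (hmom : ∀ i, ∃ C : ℝ, ∀ k, ∫⁻ ω, ENNReal.ofReal ((v k ω i) ^ 2) ∂P ≤ ENNReal.ofReal C) :
    ∃ ψ : ℕ → ℕ, StrictMono ψ ∧ ∃ ν : Measure (E × (ι → ℝ)), IsProbabilityMeasure ν ∧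
      (∀ i, ∃ C : ℝ, ∫⁻ p, ENNReal.ofReal ((p.2 i) ^ 2) ∂ν ≤ ENNReal.ofReal C) ∧
      ∀ G : (E × (ι → ℝ)) →ᵇ ℝ,
        Tendsto (fun k => ∫ ω, G (X (ψ k) ω, v (ψ k) ω) ∂P) atTop (𝓝 (∫ p, G p ∂ν)) := by
  letI : PseudoMetricSpace (E × (ι → ℝ)) := pseudoMetrizableSpacePseudoMetric _
  -- the laws of the pairs
  have hpair : ∀ k, Measurable fun ω => (X k ω, v k ω) := fun k => (hX k).prodMk (hv k)
  set ρ : ℕ → ProbabilityMeasure (E × (ι → ℝ)) := fun k =>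
    ⟨P.map (fun ω => (X k ω, v k ω)), Measure.isProbabilityMeasure_map (hpair k).aemeasurable⟩
    with hρ
  have hρk : ∀ k, ((ρ k : ProbabilityMeasure (E × (ι → ℝ))) : Measure (E × (ι → ℝ))) =
      P.map (fun ω => (X k ω, v k ω)) := fun k => rfl
  choose C hC using hmom
  have hVm : ∀ i, Measurable fun p : E × (ι → ℝ) => ENNReal.ofReal ((p.2 i) ^ 2) := fun i =>
    (((measurable_pi_apply i).comp measurable_snd).pow_const 2).ennreal_ofReal
  have hmomρ : ∀ k i, ∫⁻ p, ENNReal.ofReal ((p.2 i) ^ 2) ∂(ρ k : Measure (E × (ι → ℝ))) ≤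
      ENNReal.ofReal (C i) := fun k i => by
    rw [hρk, lintegral_map (hVm i) (hpair k)]
    exact hC i k
  -- tightness
  have htight : IsTightMeasureSet (Set.range fun k => (ρ k : Measure (E × (ι → ℝ)))) := by
    refine isTightMeasureSet_prod_of_lintegral_sq_le ?_ (fun i => ENNReal.ofReal (C i))
      (fun i => ENNReal.ofReal_ne_top) ?_
    · refine hXt.subset ?_
      rintro _ ⟨_, ⟨k, rfl⟩, rfl⟩
      exact ⟨k, (Measure.fst_map_prodMk (hv k)).symm⟩
    · rintro _ ⟨k, rfl⟩ i
      exact hmomρ k i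
  -- Prokhorov
  obtain ⟨ν, ψ, hψ, hlim⟩ := exists_subseq_tendsto_of_isTightMeasureSet_range ρ htight
  refine ⟨ψ, hψ, ν, inferInstance, fun i => ⟨C i, ?_⟩, fun G => ?_⟩
  · exact lintegral_ofReal_le_of_tendsto hlim (((continuous_apply i).comp continuous_snd).pow 2)
      (fun p => sq_nonneg _) fun k => hmomρ (ψ k) i
  · have h := (ProbabilityMeasure.tendsto_iff_forall_integral_tendsto.1 hlim) G
    refine h.congr' (Eventually.of_forall fun k => ?_)
    change ∫ p, G p ∂(ρ (ψ k) : Measure (E × (ι → ℝ))) = _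
    rw [hρk, integral_map (hpair _).aemeasurable G.continuous.aestronglyMeasurable]

omit [IsProbabilityMeasure P] [MetrizableSpace E] [SeparableSpace E] [Countable ι] in
/-- **The first marginal of a joint limit law is the limit of the first marginals.**  If
`E G(X_k, v_k) → ∫ G dν` for every bounded continuous `G : E × V → ℝ` and the laws of the `X_k`
converge weakly to `μ` (`E g(X_k) → ∫ g dμ` for bounded continuous `g`), then `ν ∘ fst⁻¹ = μ`
(test `G = g ∘ fst`; finite Borel measures on a (pseudo-)metrisable space are determined by the
integrals of bounded continuous functions). [folklore] -/
theorem fst_eq_of_tendsto_pair_law [PseudoMetrizableSpace E] {V : Type*} [TopologicalSpace V]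
    [MeasurableSpace V] {X : ℕ → Ω → E} {v : ℕ → Ω → V} {ν : Measure (E × V)}
    [IsFiniteMeasure ν] {μ : Measure E} [IsFiniteMeasure μ]
    (hconv : ∀ G : (E × V) →ᵇ ℝ,
      Tendsto (fun k => ∫ ω, G (X k ω, v k ω) ∂P) atTop (𝓝 (∫ p, G p ∂ν)))
    (hlaw : ∀ g : E →ᵇ ℝ, Tendsto (fun k => ∫ ω, g (X k ω) ∂P) atTop (𝓝 (∫ x, g x ∂μ))) :
    ν.fst = μ := by
  letI : PseudoMetricSpace E := pseudoMetrizableSpacePseudoMetric E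
  haveI : IsFiniteMeasure ν.fst := by rw [Measure.fst]; infer_instance
  refine ext_of_forall_integral_eq_of_IsFiniteMeasure fun g => ?_
  have hG := hconv (g.compContinuous ⟨Prod.fst, continuous_fst⟩)
  simp only [BoundedContinuousFunction.compContinuous_apply, ContinuousMap.coe_mk] at hG
  rw [Measure.fst, integral_map measurable_fst.aemeasurable g.continuous.aestronglyMeasurable]
  exact tendsto_nhds_unique hG (hlaw g)

omit [IsProbabilityMeasure P] [TopologicalSpace E] [MetrizableSpace E] [SeparableSpace E]
  [MeasurableSpace E] [BorelSpace E] [Countable ι] in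
/-- Bochner-side bookkeeping for the moment hypothesis of `exists_subseq_tendsto_pair_law`: if
`|t| ≤ s` pointwise with `s²` integrable and `∫ s² dP ≤ C`, then `∫⁻ t² dP ≤ C` in `[0, ∞]`.
[folklore] -/
theorem lintegral_ofReal_sq_le_of_abs_le {t s : Ω → ℝ} (hts : ∀ ω, |t ω| ≤ s ω)
    (hs : Integrable (fun ω => s ω ^ 2) P) {C : ℝ} (hC : ∫ ω, s ω ^ 2 ∂P ≤ C) :
    ∫⁻ ω, ENNReal.ofReal (t ω ^ 2) ∂P ≤ ENNReal.ofReal C := by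
  calc ∫⁻ ω, ENNReal.ofReal (t ω ^ 2) ∂P ≤ ∫⁻ ω, ENNReal.ofReal (s ω ^ 2) ∂P :=
        lintegral_mono fun ω => ENNReal.ofReal_le_ofReal
          (sq_le_sq' (abs_le.1 (hts ω)).1 (abs_le.1 (hts ω)).2)
    _ = ENNReal.ofReal (∫ ω, s ω ^ 2 ∂P) :=
        (ofReal_integral_eq_lintegral_ofReal hs (Eventually.of_forall fun ω => sq_nonneg _)).symm
    _ ≤ ENNReal.ofReal C := ENNReal.ofReal_le_ofReal hC

end Pair

end Literature.Probability.Distributions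

end
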